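import Literature.MathematicalPhysics.QuantumFieldTheory.Balaban1983to89.B13Lemma3TorusTerms
import Literature.MathematicalPhysics.QuantumFieldTheory.Balaban1983to89.B13Lemma3WindowNonvacuity
import Literature.MathematicalPhysics.QuantumFieldTheory.Balaban1983to89.B13Bound143OneShot

/-!
# `Balaban1983to89.B13Lemma3TorusNonvacuity` — T. Bałaban, *Renormalization group approach to lattice gauge field
theories. II. Cluster expansions*, Commun. Math. Phys. **116** (1988) 1–22 [Balaban1988RG2Cluster]: NON-VACUITY of the
numerical restrictions on the constants under which the §2 chain on the two-scale TORUS model was landed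
(`B13Lemma3Torus.bound238_torus`, `B13Lemma3TorusTerms.bound238_torus_of_226`,
`B13Lemma3TorusTerms.deliverables_torus_termwise_of_226`) — the torus twin of `B13Lemma3WindowNonvacuity`.

statement-level skeleton of published theorems with citation tags; proofs where landed; nothing here is a claim about the Yang–Mills mass gap

p. 21, verbatim: *"The assumptions allow finally us to fix all the constants, or rather bounds on these constants."* The
torus theorems carry the printed restrictions of pp. 17–21 (R15–R18, R20, R22–R24, the smallness conditions of
(2.29)/(2.31), the choice of the absolute constants O(1) of (2.37)/(2.38)/(2.41)) as explicit real-number hypotheses on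
`c : B13.Consts`, on the auxiliary rates `a, a₂, a₂', a₅, Aabs, Bc` and on the bond-cube size `M`; the list is the
window list of `B13Lemma3WindowChain.deliverables_window_of_226` except that the (2.32) constant «properly adapted» to
the periodic carrier is 2 + 4d = 18 (`B13Ineq232Torus.ineq232_torus_four`, covered by `B13.Consts.R16repaired`) instead
of the window's 1 + 4d = 17, in the two restrictions R16 (18(1 − 4δ)κ ≤ a/20) and R20 (18(1 − 7δ)ℓκ ≤ ½(κ₁ − 1)).  The
window witness `B13Lemma3WindowNonvacuity.consts` satisfies its R20 with EQUALITY at 17, so it does not transfer; this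
file exhibits the adjusted assignment (d = 4, L = 8, ℓ = ½L = 4, δ = 3/40, κ = 20(κ₀(64,8) + 64), the window's α₆, ε₂,
A₁, A₂ and rate a = 20(340κ + 1/ε₂) UNCHANGED — `B13Lemma3WindowNonvacuity.Kw … ε₂w`, `aw` are reused, not re-declared —
and κ₁ − 1 = 36(1 − 7δ)·4κ in place of 34(…), ε₁ read off from ε₂ = 2E₀ε₁C₁α₄⁻¹α₆⁻¹M^q e^{C₂κ₁} accordingly) at which
every hypothesis of the torus list holds (Part 3, one private lemma per hypothesis — the window file's lemmas are
private, so they are re-proved here verbatim except the five that see κ₁ or the constant 18), so that the hypothesis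
lists of the torus theorems are jointly satisfiable with ε₁ > 0 (`numerics_nonvacuous`) and the torus chain specializes
to a statement whose only remaining inputs are the model's structural ones (`deliverables_torus_consts`, on
`B13Lemma3Torus.TwoTorusStep 4 8 N′` with bond-cube side 1).  As for the window: the witness says nothing about the
size of the physical constants; it certifies only that the inequalities as typed are consistent.
-/

namespace Literature.MathematicalPhysics.QuantumFieldTheory.Balaban1983to89.B13Lemma3TorusNonvacuity

open Literature.MathematicalPhysics.QuantumFieldTheory.Balaban1983to89
open Literature.MathematicalPhysics.QuantumFieldTheory.Balaban1983to89.TreeLengthTorus (TPt TDom tsys)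
open Literature.MathematicalPhysics.QuantumFieldTheory.Balaban1983to89.TreeLengthTorusGeometry (TTouch)
open Literature.MathematicalPhysics.QuantumFieldTheory.Balaban1983to89.B12TreeDecay (kappa₀ K₀ K₀_pos kappa₀_nonneg)
open Literature.MathematicalPhysics.QuantumFieldTheory.Balaban1983to89.B13Lemma3TorusData (TBond)
open Literature.MathematicalPhysics.QuantumFieldTheory.Balaban1983to89.B13Lemma3Torus (TwoTorusStep)
open Literature.MathematicalPhysics.QuantumFieldTheory.Balaban1983to89.B13Lemma3TorusTerms (terms weight)
open Literature.MathematicalPhysics.QuantumFieldTheory.Balaban1983to89.B13Resummation (locE)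
open Literature.MathematicalPhysics.QuantumFieldTheory.Balaban1983to89.B13Lemma3WindowNonvacuity
  (Kw κ₀w κw δw μw α₆w Aup A₁w A₂w ε₂w aw)

noncomputable section

/-! ## Part 1. The witness -/

/-- κ₁ := 1 + 36 (1 − 7δ)·½L·κ (restriction R20 with the TORUS constant 18, with equality); the window takes 34.
[cite: Balaban1988RG2Cluster, p.20 (restriction on κ₁) and p.21 (closing paragraph)] -/
def κ₁t : ℝ := 1 + 36 * μw

/-- ε₁ read off from ε₂ = 2E₀ε₁C₁α₄⁻¹α₆⁻¹M^q e^{C₂κ₁} = ε₂w at E₀ = 2, C₁ = α₄ = C₂ = 1, q = 0, κ₁ = κ₁t.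
[cite: Balaban1988RG2Cluster, p.19 (the product defining ε₂) and p.21] -/
def ε₁t : ℝ := ε₂w * α₆w * Real.exp (-κ₁t) / 4

/-- The torus witness constants: the window witness `B13Lemma3WindowNonvacuity.consts` with κ₁ := `κ₁t` and ε₁ := `ε₁t`.
[cite: Balaban1988RG2Cluster, p.21 (closing paragraph: "The assumptions allow finally us to fix all the constants")] -/
def consts : B13.Consts where
  L := 8
  q := 0
  M := κw + 1
  κ := κw
  κ₁ := κ₁t
  δ := δw
  δ₀ := 1
  E₀ := 2
  ε₁ := ε₁t
  C₁ := 1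
  C₂ := 1
  C₃ := 1
  α₀ := 1
  α₁ := 1
  α₄ := 1
  α₅ := 1
  α₆ := α₆w
  γ₂ := 1
  γ := 1
  A₁ := A₁w
  A₂ := A₂w

/-! ## Part 2. Elementary facts about the witness -/

/-- κ₀(64, 8) = 64 log 162 (`TreeLengthCubeSystem.kappa₀_four`); private plumbing. [folklore] -/
private theorem κ₀w_eq : κ₀w = 64 * Real.log 162 := by
  have h := TreeLengthCubeSystem.kappa₀_four
  norm_num at h
  exact h

/-- κ₀ ≥ 0; private plumbing. [folklore] -/
private theorem κ₀w_nonneg : 0 ≤ κ₀w := kappa₀_nonneg (by norm_num) 8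

/-- K₀ > 0; private plumbing. [folklore] -/
private theorem Kw_pos : 0 < Kw := K₀_pos 64 8

/-- K₀(64, 8) ≥ 1 (as e^{64 log 162} ≥ 81; cf. `B12StepFromB13.one_le_K₀_four`); private plumbing. [folklore] -/
private theorem one_le_Kw : 1 ≤ Kw := by
  have hκ : kappa₀ 64 8 = 64 * Real.log 162 := κ₀w_eq
  show 1 ≤ K₀ 64 8
  unfold K₀
  rw [hκ, le_div_iff₀ (by positivity)]
  have h81 : Real.log 81 ≤ 64 * Real.log 162 := by
    have h1 : Real.log 81 ≤ Real.log 162 := Real.log_le_log (by norm_num) (by norm_num)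
    have h2 : 0 ≤ Real.log 162 := Real.log_nonneg (by norm_num)
    linarith
  have h := Real.exp_le_exp.mpr h81
  rw [Real.exp_log (by norm_num : (0 : ℝ) < 81)] at h
  norm_num
  linarith

/-- κ ≥ 1280; private plumbing. [folklore] -/
private theorem κw_ge : 1280 ≤ κw := by
  unfold κw; linarith [κ₀w_nonneg]

/-- κ > 0; private plumbing. [folklore] -/
private theorem κw_pos : 0 < κw := by linarith [κw_ge]

/-- (1 − 7δ)·4·κ = (19/10)κ at δ = 3/40; private plumbing. [folklore] -/
private theorem μw_eq : μw = (19 / 10) * κw := by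
  unfold μw δw; ring

/-- μ ≥ 0; private plumbing. [folklore] -/
private theorem μw_nonneg : 0 ≤ μw := by
  rw [μw_eq]; linarith [κw_pos]

/-- α₆ > 0; private plumbing. [folklore] -/
private theorem α₆w_pos : 0 < α₆w := by
  unfold α₆w; have := Kw_pos; positivity

/-- α₆ ≤ 1; private plumbing. [folklore] -/
private theorem α₆w_le_one : α₆w ≤ 1 := by
  unfold α₆w
  rw [inv_le_one_iff₀]
  right
  have h1 : 1 ≤ Real.exp 1 := Real.one_le_exp (by norm_num)
  nlinarith [one_le_Kw, h1]

/-- Aup ≥ 1; private plumbing. [folklore] -/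
private theorem one_le_Aup : 1 ≤ Aup := by
  unfold Aup
  have h1 : 1 ≤ Real.exp 64 := Real.one_le_exp (by norm_num)
  nlinarith [one_le_Kw, h1]

/-- Aup > 0; private plumbing. [folklore] -/
private theorem Aup_pos : 0 < Aup := by linarith [one_le_Aup]

/-- A₁ ≥ 1; private plumbing. [folklore] -/
private theorem one_le_A₁w : 1 ≤ A₁w := by
  unfold A₁w
  rw [le_div_iff₀ α₆w_pos]
  have h1 : 1 ≤ Real.exp 64 := Real.one_le_exp (by norm_num)
  nlinarith [one_le_Aup, h1, α₆w_le_one, α₆w_pos]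

/-- A₁ > 0; private plumbing. [folklore] -/
private theorem A₁w_pos : 0 < A₁w := by linarith [one_le_A₁w]

/-- A₂ ≥ 1; private plumbing. [folklore] -/
private theorem one_le_A₂w : 1 ≤ A₂w := by
  unfold A₂w
  have h1 : 1 ≤ Real.exp 1 := Real.one_le_exp (by norm_num)
  have h2 : 1 ≤ Kw ^ 2 := by nlinarith [one_le_Kw]
  nlinarith [h1, h2]

/-- A₂ > 0; private plumbing. [folklore] -/
private theorem A₂w_pos : 0 < A₂w := by linarith [one_le_A₂w]

/-- The denominator of `ε₂w`. [folklore] -/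
private theorem den_pos : 0 < 2 * 10000 * Aup * A₁w * A₂w * Kw * 576 := by
  have := Aup_pos; have := A₁w_pos; have := A₂w_pos; have := Kw_pos
  positivity

/-- ε₂ > 0; private plumbing. [folklore] -/
private theorem ε₂w_pos : 0 < ε₂w := by
  unfold ε₂w
  have := α₆w_pos; have := den_pos
  positivity

/-- ε₂ ≥ 0; private plumbing. [folklore] -/
private theorem ε₂w_nonneg : 0 ≤ ε₂w := ε₂w_pos.le

/-- `ε₂w · e^{5κ + 5μ + 1} · (2·10⁴·Aup·A₁·A₂·Kw·576) = α₆`. [folklore] -/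
private theorem ε₂w_mul : ε₂w * Real.exp (5 * κw + 5 * μw + 1) * (2 * 10000 * Aup * A₁w * A₂w * Kw * 576) = α₆w := by
  unfold ε₂w
  have h1 := ne_of_gt Aup_pos; have h2 := ne_of_gt A₁w_pos; have h3 := ne_of_gt A₂w_pos; have h4 := ne_of_gt Kw_pos
  rw [Real.exp_neg]
  field_simp

/-- The basic smallness of `ε₂w`: `ε₂w · e^{5κ + 5μ + 1} · X ≤ α₆` for every factor `X ≤ 2·10⁴·Aup·A₁·A₂·Kw·576`. [folklore] -/
private theorem ε₂w_le {X : ℝ} (hX : X ≤ 2 * 10000 * Aup * A₁w * A₂w * Kw * 576) :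
    ε₂w * Real.exp (5 * κw + 5 * μw + 1) * X ≤ α₆w := by
  calc ε₂w * Real.exp (5 * κw + 5 * μw + 1) * X
      ≤ ε₂w * Real.exp (5 * κw + 5 * μw + 1) * (2 * 10000 * Aup * A₁w * A₂w * Kw * 576) := by
        apply mul_le_mul_of_nonneg_left hX
        exact mul_nonneg ε₂w_nonneg (Real.exp_pos _).le
    _ = α₆w := ε₂w_mul

/-- ε₂ ≤ 1; private plumbing. [folklore] -/
private theorem ε₂w_le_one : ε₂w ≤ 1 := by
  have h := ε₂w_le (X := 1) (by
    have := one_le_Aup; have := one_le_A₁w; have := one_le_A₂w; have := one_le_Kw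
    nlinarith [mul_le_mul this one_le_A₁w (by norm_num) (by linarith), Aup_pos, A₁w_pos, A₂w_pos, Kw_pos,
      mul_pos Aup_pos A₁w_pos, mul_pos (mul_pos Aup_pos A₁w_pos) A₂w_pos,
      mul_pos (mul_pos (mul_pos Aup_pos A₁w_pos) A₂w_pos) Kw_pos])
  have h1 : 1 ≤ Real.exp (5 * κw + 5 * μw + 1) := Real.one_le_exp (by nlinarith [κw_pos, μw_nonneg])
  nlinarith [ε₂w_pos, α₆w_le_one]

/-! ### The derived products at the witness -/

/-- L = 8 at the witness; private plumbing. [folklore] -/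
private theorem L_consts : consts.L = 8 := rfl

/-- ½L = 4 at the witness; private plumbing. [folklore] -/
private theorem half_L : ((consts.L : ℝ) / 2) = 4 := by
  rw [L_consts]; norm_num

/-- The p. 19 product ε₂ = 2E₀ε₁C₁α₄⁻¹α₆⁻¹M^q e^{C₂κ₁} evaluates to `ε₂w` at the witness; private plumbing. [folklore] -/
private theorem eps2_consts : consts.eps2 = ε₂w := by
  rw [B13.Consts.eps2_printed]
  show 2 * 2 * (ε₂w * α₆w * Real.exp (-κ₁t) / 4) * 1 * (1 : ℝ)⁻¹ * α₆w⁻¹ * (κw + 1) ^ 0 * Real.exp (1 * κ₁t) = ε₂w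
  have hα := ne_of_gt α₆w_pos
  rw [Real.exp_neg]
  field_simp
  ring

/-- C₃ε₁ = 2(L+2)⁴A₁ε₂ = 2·10⁴·A₁·ε₂ at the witness; private plumbing. [folklore] -/
private theorem C3ε_consts : consts.C3act * consts.ε₁ = 2 * 10000 * A₁w * ε₂w := by
  rw [B13.Consts.C3act_mul_eps1, eps2_consts, L_consts]
  show 2 * (((8 : ℕ) : ℝ) + 2) ^ 4 * A₁w * ε₂w = 2 * 10000 * A₁w * ε₂w
  norm_num

/-- The O(1) of (2.37) at the witness rate, `A(a) = K₀ e^{64 e^{−a/20}}`, is at most `Aup`. [folklore] -/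
private theorem A_le_Aup : K₀ 64 8 * Real.exp (Real.exp (-(aw / 20)) * 64) ≤ Aup := by
  unfold Aup
  apply mul_le_mul_of_nonneg_left _ (K₀_pos 64 8).le
  rw [Real.exp_le_exp]
  have h : Real.exp (-(aw / 20)) ≤ 1 := by
    rw [Real.exp_le_one_iff]
    have : 0 ≤ aw := by unfold aw; have := ε₂w_pos; have := κw_pos; positivity
    linarith
  linarith

/-- The O(1) of (2.37) at the witness rate is ≥ 0; private plumbing. [folklore] -/
private theorem A_nonneg : 0 ≤ K₀ 64 8 * Real.exp (Real.exp (-(aw / 20)) * 64) :=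
  mul_nonneg (K₀_pos 64 8).le (Real.exp_pos _).le

/-- The per-member constant (L+2)⁴·A·ε₂ = 10⁴·A·ε₂ at the witness; private plumbing. [folklore] -/
private theorem memberF_consts (A : ℝ) : B13Step237.memberF consts A = 10000 * A * ε₂w := by
  unfold B13Step237.memberF
  rw [eps2_consts, L_consts]
  norm_num

/-- a/20 = 340κ + 1/ε₂; private plumbing. [folklore] -/
private theorem aw_div : aw / 20 = 340 * κw + 1 / ε₂w := by
  unfold aw; ring

/-- a ≥ 0; private plumbing. [folklore] -/
private theorem aw_nonneg : 0 ≤ aw := by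
  unfold aw; have := ε₂w_pos; have := κw_pos; positivity

/-- `e^{−1/x} ≤ x` for `x > 0`. [folklore] -/
private theorem exp_neg_inv_le {x : ℝ} (hx : 0 < x) : Real.exp (-(1 / x)) ≤ x := by
  have h1 : 1 / x ≤ Real.exp (1 / x) := by linarith [Real.add_one_le_exp (1 / x)]
  rw [Real.exp_neg, inv_le_comm₀ (Real.exp_pos _) hx]
  calc x⁻¹ = 1 / x := (one_div x).symm
    _ ≤ Real.exp (1 / x) := h1

/-- e^{−a/20} ≤ ε₂ (restriction R17 at the witness); private plumbing. [folklore] -/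
private theorem exp_aw_le_ε₂w : Real.exp (-(aw / 20)) ≤ ε₂w := by
  rw [aw_div]
  calc Real.exp (-(340 * κw + 1 / ε₂w)) ≤ Real.exp (-(1 / ε₂w)) := by
        rw [Real.exp_le_exp]; linarith [κw_pos]
    _ ≤ ε₂w := exp_neg_inv_le ε₂w_pos

/-- e^{−a/20} ≤ 1; private plumbing. [folklore] -/
private theorem exp_aw_le_one : Real.exp (-(aw / 20)) ≤ 1 := by
  rw [Real.exp_le_one_iff]; linarith [aw_nonneg]

/-! ### Lower bounds for the denominator of `ε₂w` -/

/-- The denominator of ε₂ is ≥ 1; private plumbing. [folklore] -/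
private theorem den_ge_one : 1 ≤ 2 * 10000 * Aup * A₁w * A₂w * Kw * 576 := by
  have h1 : (1 : ℝ) ≤ 2 * 10000 := by norm_num
  have h2 := one_le_mul_of_one_le_of_one_le h1 one_le_Aup
  have h3 := one_le_mul_of_one_le_of_one_le h2 one_le_A₁w
  have h4 := one_le_mul_of_one_le_of_one_le h3 one_le_A₂w
  have h5 := one_le_mul_of_one_le_of_one_le h4 one_le_Kw
  exact one_le_mul_of_one_le_of_one_le h5 (by norm_num)

/-- The denominator of ε₂ dominates 2·10⁴·Aup; private plumbing. [folklore] -/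
private theorem den_ge_Aup : 2 * 10000 * Aup ≤ 2 * 10000 * Aup * A₁w * A₂w * Kw * 576 := by
  have h0 : 0 ≤ 2 * 10000 * Aup := by linarith [Aup_pos]
  calc 2 * 10000 * Aup ≤ 2 * 10000 * Aup * (A₁w * A₂w * Kw * 576) :=
        le_mul_of_one_le_right h0 (one_le_mul_of_one_le_of_one_le
          (one_le_mul_of_one_le_of_one_le (one_le_mul_of_one_le_of_one_le one_le_A₁w one_le_A₂w) one_le_Kw)
          (by norm_num))
    _ = _ := by ring

/-- The denominator of ε₂ dominates 2·10⁴·A₁·K₀·576; private plumbing. [folklore] -/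
private theorem den_ge_A₁K : 2 * 10000 * A₁w * Kw * 576 ≤ 2 * 10000 * Aup * A₁w * A₂w * Kw * 576 := by
  have h0 : 0 ≤ 2 * 10000 * A₁w * Kw * 576 := by have := A₁w_pos; have := Kw_pos; positivity
  calc 2 * 10000 * A₁w * Kw * 576 ≤ 2 * 10000 * A₁w * Kw * 576 * (Aup * A₂w) :=
        le_mul_of_one_le_right h0 (one_le_mul_of_one_le_of_one_le one_le_Aup one_le_A₂w)
    _ = _ := by ring

/-- The denominator of ε₂ dominates 2·10⁴·A₁·A₂; private plumbing. [folklore] -/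
private theorem den_ge_A₁A₂ : 2 * 10000 * A₁w * A₂w ≤ 2 * 10000 * Aup * A₁w * A₂w * Kw * 576 := by
  have h0 : 0 ≤ 2 * 10000 * A₁w * A₂w := by have := A₁w_pos; have := A₂w_pos; positivity
  calc 2 * 10000 * A₁w * A₂w ≤ 2 * 10000 * A₁w * A₂w * (Aup * Kw * 576) :=
        le_mul_of_one_le_right h0
          (one_le_mul_of_one_le_of_one_le (one_le_mul_of_one_le_of_one_le one_le_Aup one_le_Kw) (by norm_num))
    _ = _ := by ring

/-- The working form of the smallness of `ε₂w`: `ε₂w · e^{E} · X ≤ α₆` whenever `E ≤ 5κ + 5μ + 1` and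
`0 ≤ X ≤ 2·10⁴·Aup·A₁·A₂·Kw·576`. [folklore] -/
private theorem ε₂w_small {X E : ℝ} (hX₀ : 0 ≤ X) (hX : X ≤ 2 * 10000 * Aup * A₁w * A₂w * Kw * 576)
    (hE : E ≤ 5 * κw + 5 * μw + 1) : ε₂w * Real.exp E * X ≤ α₆w := by
  calc ε₂w * Real.exp E * X ≤ ε₂w * Real.exp (5 * κw + 5 * μw + 1) * X := by
        apply mul_le_mul_of_nonneg_right _ hX₀
        exact mul_le_mul_of_nonneg_left (Real.exp_le_exp.mpr hE) ε₂w_nonneg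
    _ ≤ α₆w := ε₂w_le hX

/-- … and without the exponential: `ε₂w · X ≤ α₆ ≤ 1`. [folklore] -/
private theorem ε₂w_small' {X : ℝ} (hX₀ : 0 ≤ X) (hX : X ≤ 2 * 10000 * Aup * A₁w * A₂w * Kw * 576) :
    ε₂w * X ≤ 1 := by
  have h := ε₂w_small hX₀ hX (le_refl _)
  have h1 : 1 ≤ Real.exp (5 * κw + 5 * μw + 1) := Real.one_le_exp (by nlinarith [κw_pos, μw_nonneg])
  have h2 : ε₂w * X ≤ ε₂w * Real.exp (5 * κw + 5 * μw + 1) * X := by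
    have : ε₂w * X * 1 ≤ ε₂w * X * Real.exp (5 * κw + 5 * μw + 1) :=
      mul_le_mul_of_nonneg_left h1 (mul_nonneg ε₂w_nonneg hX₀)
    linarith
  linarith [α₆w_le_one]

/-! ## Part 3. The restrictions, one by one, at the witness -/

/-- L ≥ 8 at the witness; private plumbing. [folklore] -/
private theorem c_L : 8 ≤ consts.L := L_consts.ge

/-- α₆ > 0 at the witness; private plumbing. [folklore] -/
private theorem c_α₆ : 0 < consts.α₆ := α₆w_pos

/-- ε₂ ≥ 0 at the witness; private plumbing. [folklore] -/
private theorem c_eps2 : 0 ≤ consts.eps2 := by rw [eps2_consts]; exact ε₂w_nonneg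

/-- δ ≥ 0 at the witness; private plumbing. [folklore] -/
private theorem c_δ : 0 ≤ consts.δ := by show (0 : ℝ) ≤ 3 / 40; norm_num

/-- 1 − 7δ ≥ 0 at the witness; private plumbing. [folklore] -/
private theorem c_δ7 : 0 ≤ 1 - 7 * consts.δ := by show (0 : ℝ) ≤ 1 - 7 * (3 / 40); norm_num

/-- κ ≥ 0 at the witness; private plumbing. [folklore] -/
private theorem c_κ : 0 ≤ consts.κ := κw_pos.le

/-- R15 (ε₂ e^{5κ} ≤ 1, p. 18) at the witness; private plumbing. [folklore] -/
private theorem c_R15 : consts.R15 := by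
  unfold B13.Consts.R15
  rw [eps2_consts]
  show ε₂w * Real.exp (5 * κw) ≤ 1
  have h := ε₂w_small (X := 1) (E := 5 * κw) (by norm_num) den_ge_one (by linarith [μw_nonneg])
  linarith [α₆w_le_one]

/-- R16 in the TORUS form 18(1 − 4δ)κ ≤ a/20 (p. 18; the torus (2.32) constant is 2 + 4d = 18, `B13.Consts.R16repaired`) at the witness; private plumbing. [folklore] -/
private theorem c_R16 : 18 * ((1 - 4 * consts.δ) * consts.κ) ≤ aw / 20 := by
  rw [aw_div]
  show 18 * ((1 - 4 * (3 / 40 : ℝ)) * κw) ≤ 340 * κw + 1 / ε₂w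
  have h1 : 0 ≤ 1 / ε₂w := (one_div_pos.mpr ε₂w_pos).le
  nlinarith [κw_pos]

/-- 4κ ≤ a/20 (p. 18) at the witness; private plumbing. [folklore] -/
private theorem c_R16' : 4 * consts.κ ≤ aw / 20 := by
  rw [aw_div]
  show 4 * κw ≤ 340 * κw + 1 / ε₂w
  have h1 : 0 ≤ 1 / ε₂w := (one_div_pos.mpr ε₂w_pos).le
  linarith [κw_pos]

/-- R17 (e^{−a/20} ≤ ε₂, p. 19) at the witness; private plumbing. [folklore] -/
private theorem c_R17 : Real.exp (-(aw / 20)) ≤ consts.eps2 := by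
  rw [eps2_consts]; exact exp_aw_le_ε₂w

/-- The smallness condition of (2.31) at bond-cube side 1 at the witness; private plumbing. [folklore] -/
private theorem c_231 : 2 * (4 : ℝ) * (((1 : ℕ) : ℝ)) ^ 4 * Real.exp (-(aw / 10)) ≤ aw / 20 := by
  have h1 : Real.exp (-(aw / 10)) ≤ 1 := by rw [Real.exp_le_one_iff]; linarith [aw_nonneg]
  have h2 : 8 ≤ aw / 20 := by
    rw [aw_div]
    have : 0 ≤ 1 / ε₂w := (one_div_pos.mpr ε₂w_pos).le
    linarith [κw_ge]
  norm_num
  linarith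

/-- The rate condition of (2.29) (κ₀ + a₂ ≤ δκ, a₂ = 1) at the witness; private plumbing. [folklore] -/
private theorem c_κ229 : kappa₀ 64 8 + 1 ≤ consts.δ * consts.κ := by
  show κ₀w + 1 ≤ 3 / 40 * (20 * (κ₀w + 64))
  linarith [κ₀w_nonneg]

/-- The smallness condition of (2.29) (α₆ e^{a₂} K₀ 64 ≤ a₂, a₂ = 1; equality) at the witness; private plumbing. [folklore] -/
private theorem c_sm229 : consts.α₆ * Real.exp 1 * K₀ 64 8 * 64 ≤ 1 := by
  show (Real.exp 1 * Kw * 64)⁻¹ * Real.exp 1 * Kw * 64 ≤ 1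
  have h1 := ne_of_gt Kw_pos
  have h2 := (Real.exp_pos 1).ne'
  have h : (Real.exp 1 * Kw * 64)⁻¹ * Real.exp 1 * Kw * 64 = 1 := by field_simp
  exact h.le

/-- The absorption 64 e^{−a/20} ≤ δκ at the witness; private plumbing. [folklore] -/
private theorem c_absk : Real.exp (-(aw / 20)) * 64 ≤ consts.δ * consts.κ := by
  show Real.exp (-(aw / 20)) * 64 ≤ 3 / 40 * (20 * (κ₀w + 64))
  linarith [exp_aw_le_one, κ₀w_nonneg]

/-- R18 ((L+2)⁴O(1)ε₂ ≤ ½, p. 20) at the witness; private plumbing. [folklore] -/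
private theorem c_18half : B13Step237.R18half consts (K₀ 64 8 * Real.exp (Real.exp (-(aw / 20)) * 64)) := by
  unfold B13Step237.R18half
  rw [memberF_consts]
  have h := ε₂w_small' (X := 2 * 10000 * Aup) (by linarith [Aup_pos]) den_ge_Aup
  have h1 : 10000 * (K₀ 64 8 * Real.exp (Real.exp (-(aw / 20)) * 64)) * ε₂w ≤ 10000 * Aup * ε₂w :=
    mul_le_mul_of_nonneg_right (mul_le_mul_of_nonneg_left A_le_Aup (by norm_num)) ε₂w_nonneg
  linarith

/-- R18 in the sharp form 2(L+2)⁴O(1)ε₂ e^{5(1−7δ)ℓκ} ≤ α₆ (p. 20) at the witness; private plumbing. [folklore] -/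
private theorem c_18sharp :
    B13Step237.R18sharp consts (K₀ 64 8 * Real.exp (Real.exp (-(aw / 20)) * 64)) ((consts.L : ℝ) / 2) := by
  unfold B13Step237.R18sharp B13Step237.bracketF
  rw [memberF_consts, half_L]
  show 2 * (10000 * (K₀ 64 8 * Real.exp (Real.exp (-(aw / 20)) * 64)) * ε₂w) *
      Real.exp (5 * ((1 - 7 * δw) * 4 * κw)) ≤ α₆w
  have h := ε₂w_small (X := 2 * 10000 * Aup) (E := 5 * μw) (by linarith [Aup_pos]) den_ge_Aup
    (by linarith [κw_pos])
  have hμ : (1 - 7 * δw) * 4 * κw = μw := rfl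
  rw [hμ]
  have h1 : 2 * (10000 * (K₀ 64 8 * Real.exp (Real.exp (-(aw / 20)) * 64)) * ε₂w) * Real.exp (5 * μw) ≤
      2 * (10000 * Aup * ε₂w) * Real.exp (5 * μw) := by
    apply mul_le_mul_of_nonneg_right _ (Real.exp_pos _).le
    apply mul_le_mul_of_nonneg_left _ (by norm_num)
    exact mul_le_mul_of_nonneg_right (mul_le_mul_of_nonneg_left A_le_Aup (by norm_num)) ε₂w_nonneg
  calc _ ≤ 2 * (10000 * Aup * ε₂w) * Real.exp (5 * μw) := h1
    _ = ε₂w * Real.exp (5 * μw) * (2 * 10000 * Aup) := by ring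
    _ ≤ α₆w := h

/-- The rate condition of (2.29) at the k+1 scale (κ₀ + a₂′ ≤ δℓκ, a₂′ = 1) at the witness; private plumbing. [folklore] -/
private theorem c_κ229' : kappa₀ 64 8 + 1 ≤ consts.δ * ((consts.L : ℝ) / 2) * consts.κ := by
  rw [half_L]
  show κ₀w + 1 ≤ 3 / 40 * 4 * (20 * (κ₀w + 64))
  linarith [κ₀w_nonneg]

/-- R20 in the TORUS form (18(1 − 7δ)ℓκ ≤ (κ₁ − 1)/2, p. 20 with the torus (2.32) constant; equality) at the witness; private plumbing. [folklore] -/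
private theorem c_R20 : 18 * ((1 - 7 * consts.δ) * ((consts.L : ℝ) / 2) * consts.κ) ≤ (consts.κ₁ - 1) / 2 := by
  rw [half_L]
  show 18 * ((1 - 7 * δw) * 4 * κw) ≤ (1 + 36 * ((1 - 7 * δw) * 4 * κw) - 1) / 2
  linarith

/-- a₅ + e^{−(κ₁−1)/2} ≤ Aabs (a₅ = 0, Aabs = 1) at the witness; private plumbing. [folklore] -/
private theorem c_abs : 0 + Real.exp (-((consts.κ₁ - 1) / 2)) ≤ 1 := by
  show 0 + Real.exp (-((1 + 36 * μw - 1) / 2)) ≤ 1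
  have h : Real.exp (-((1 + 36 * μw - 1) / 2)) ≤ 1 := by
    rw [Real.exp_le_one_iff]; linarith [μw_nonneg]
  linarith

/-- 64·Aabs ≤ δℓκ (Aabs = 1) at the witness; private plumbing. [folklore] -/
private theorem c_Ac : 1 * 64 ≤ consts.δ * ((consts.L : ℝ) / 2) * consts.κ := by
  rw [half_L]
  show 1 * 64 ≤ 3 / 40 * 4 * (20 * (κ₀w + 64))
  linarith [κ₀w_nonneg]

/-- The choice of the O(1) of C₃ (p. 20): bracket/α₆ · e^{64 Aabs} ≤ C₃ε₁ at the witness; private plumbing. [folklore] -/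
private theorem c_C3 : B13Step237.bracketF consts (K₀ 64 8 * Real.exp (Real.exp (-(aw / 20)) * 64)) / consts.α₆ *
    Real.exp (1 * 64) ≤ consts.C3act * consts.ε₁ := by
  rw [C3ε_consts]
  unfold B13Step237.bracketF
  rw [memberF_consts]
  show 2 * (10000 * (K₀ 64 8 * Real.exp (Real.exp (-(aw / 20)) * 64)) * ε₂w) / α₆w * Real.exp (1 * 64) ≤
    2 * 10000 * (Aup * Real.exp 64 / α₆w) * ε₂w
  rw [one_mul]
  have hc : 0 ≤ 2 * 10000 * ε₂w * Real.exp 64 / α₆w := by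
    have := ε₂w_pos; have := α₆w_pos; positivity
  calc 2 * (10000 * (K₀ 64 8 * Real.exp (Real.exp (-(aw / 20)) * 64)) * ε₂w) / α₆w * Real.exp 64
      = 2 * 10000 * ε₂w * Real.exp 64 / α₆w * (K₀ 64 8 * Real.exp (Real.exp (-(aw / 20)) * 64)) := by ring
    _ ≤ 2 * 10000 * ε₂w * Real.exp 64 / α₆w * Aup := mul_le_mul_of_nonneg_left A_le_Aup hc
    _ = 2 * 10000 * (Aup * Real.exp 64 / α₆w) * ε₂w := by ring

/-- C₃ε₁ ≥ 0 at the witness; private plumbing. [folklore] -/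
private theorem c_C3pos : 0 ≤ consts.C3act * consts.ε₁ := by
  rw [C3ε_consts]; have := A₁w_pos; have := ε₂w_pos; positivity

/-- The largeness of κ used in (2.41) ⇒ (I.1.18) (`B13Closing`) at the witness; private plumbing. [folklore] -/
private theorem c_large :
    consts.κ + 2 * (64 * Real.log 162) + 2 ≤ (1 - 8 * consts.δ) * ((consts.L : ℝ) / 2) * consts.κ := by
  rw [half_L, ← κ₀w_eq]
  show 20 * (κ₀w + 64) + 2 * κ₀w + 2 ≤ (1 - 8 * (3 / 40)) * 4 * (20 * (κ₀w + 64))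
  linarith [κ₀w_nonneg]

/-- The smallness of C₃ε₁ used in (2.39)–(2.41) (`B13Closing`) at the witness; private plumbing. [folklore] -/
private theorem c_small : consts.C3act * consts.ε₁ * Real.exp (5 * consts.κ + 1) * K₀ 64 8 * 9 * 64 ≤ 1 := by
  rw [C3ε_consts]
  show 2 * 10000 * A₁w * ε₂w * Real.exp (5 * κw + 1) * Kw * 9 * 64 ≤ 1
  have h := ε₂w_small (X := 2 * 10000 * A₁w * Kw * 576) (E := 5 * κw + 1)
    (by have := A₁w_pos; have := Kw_pos; positivity) den_ge_A₁K (by linarith [μw_nonneg])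
  calc 2 * 10000 * A₁w * ε₂w * Real.exp (5 * κw + 1) * Kw * 9 * 64
      = ε₂w * Real.exp (5 * κw + 1) * (2 * 10000 * A₁w * Kw * 576) := by ring
    _ ≤ α₆w := h
    _ ≤ 1 := α₆w_le_one

/-- The O(1) of (2.41), A₂ ≥ e·9·64·K₀² (equality) at the witness; private plumbing. [folklore] -/
private theorem c_A₂ : Real.exp 1 * 9 * 64 * K₀ 64 8 ^ 2 ≤ consts.A₂ := le_refl _

/-- R22 ((1 − 10δ)·½L = 1, p. 21) at the witness; private plumbing. [folklore] -/
private theorem c_R22 : consts.R22 := by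
  unfold B13.Consts.R22
  rw [half_L]
  show (1 - 10 * (3 / 40 : ℝ)) * 4 = 1
  norm_num

/-- R23 (O(1)C₃ε₁ ≤ ½E₀, p. 21) at the witness; private plumbing. [folklore] -/
private theorem c_R23 : consts.R23 := by
  unfold B13.Consts.R23
  rw [mul_assoc, C3ε_consts]
  show A₂w * (2 * 10000 * A₁w * ε₂w) ≤ 2 / 2
  have h := ε₂w_small' (X := 2 * 10000 * A₁w * A₂w) (by have := A₁w_pos; have := A₂w_pos; positivity)
    den_ge_A₁A₂
  calc A₂w * (2 * 10000 * A₁w * ε₂w) = ε₂w * (2 * 10000 * A₁w * A₂w) := by ring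
    _ ≤ 1 := h
    _ = 2 / 2 := by norm_num

/-- R24 (κ + 1 ≤ δ₀M, p. 21) at the witness; private plumbing. [folklore] -/
private theorem c_R24 : consts.R24sharp := by
  unfold B13.Consts.R24sharp
  show κw + 1 ≤ 1 * (κw + 1)
  linarith

/-- E₀ ≥ 0 at the witness; private plumbing. [folklore] -/
private theorem c_E₀ : 0 ≤ consts.E₀ := by show (0 : ℝ) ≤ 2; norm_num

/-- 64·Bc ≤ ½E₀ (Bc = 1/64) at the witness; private plumbing. [folklore] -/
private theorem c_E₀def : 1 / 64 * 64 ≤ consts.E₀ / 2 := by show (1 : ℝ) / 64 * 64 ≤ 2 / 2; norm_num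

/-- ε₁ > 0 at the witness (non-degeneracy); private plumbing. [folklore] -/
private theorem c_ε₁ : 0 < consts.ε₁ := by
  show 0 < ε₂w * α₆w * Real.exp (-κ₁t) / 4
  have := ε₂w_pos; have := α₆w_pos
  positivity

/-! ## Part 4. Non-vacuity -/

/-- **NON-VACUITY OF THE NUMERICAL RESTRICTIONS OF THE TORUS CHAIN.** p. 21, verbatim: *"The assumptions allow finally
us to fix all the constants, or rather bounds on these constants."* — the explicit real-number hypotheses on the
constants carried by `B13Lemma3Torus.bound238_torus` / `B13Lemma3TorusTerms.bound238_torus_of_226` (restrictions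
R15–R18, R20 — R16 and R20 with the TORUS (2.32) constant 18 —, the smallness conditions of (2.29) and (2.31), the
choice of the O(1) of (2.37)/(2.38)) together with those of `B13Lemma3TorusTerms.deliverables_torus_termwise_of_226`
(the closing numerics of pp. 20–22: R22, R23, R24, the O(1) of (2.41), the ½E₀ bookkeeping) are JOINTLY SATISFIABLE,
with `ε₁ > 0`: witnessed by `consts`, bond-cube side `M = 1`, rate `a = aw`, `a₂ = a₂' = 1`, `a₅ = 0`, `Aabs = 1`,
`Bc = 1/64`.  Window version (constant 17): `B13Lemma3WindowNonvacuity.numerics_nonvacuous`. [cite: Balaban1988RG2Cluster, p.21 (closing paragraph: "The assumptions allow finally us to fix all the constants")] -/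
theorem numerics_nonvacuous :
    ∃ (c : B13.Consts) (M : ℕ) (a a₂ a₂' a₅ Aabs Bc : ℝ),
      8 ≤ c.L ∧ 0 < M ∧ 0 < c.ε₁ ∧ 0 < c.α₆ ∧ 0 ≤ c.eps2 ∧ 0 ≤ c.δ ∧ 0 ≤ 1 - 7 * c.δ ∧ 0 ≤ c.κ ∧ 0 ≤ a ∧
      c.R15 ∧ 18 * ((1 - 4 * c.δ) * c.κ) ≤ a / 20 ∧ 4 * c.κ ≤ a / 20 ∧ Real.exp (-(a / 20)) ≤ c.eps2 ∧
      2 * (4 : ℝ) * (M : ℝ) ^ 4 * Real.exp (-(a / 10)) ≤ a / 20 ∧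
      0 ≤ a₂ ∧ kappa₀ 64 8 + a₂ ≤ c.δ * c.κ ∧ c.α₆ * Real.exp a₂ * K₀ 64 8 * 64 ≤ a₂ ∧
      Real.exp (-(a / 20)) * 64 ≤ c.δ * c.κ ∧
      B13Step237.R18half c (K₀ 64 8 * Real.exp (Real.exp (-(a / 20)) * 64)) ∧
      B13Step237.R18sharp c (K₀ 64 8 * Real.exp (Real.exp (-(a / 20)) * 64)) ((c.L : ℝ) / 2) ∧
      0 ≤ a₂' ∧ kappa₀ 64 8 + a₂' ≤ c.δ * ((c.L : ℝ) / 2) * c.κ ∧ c.α₆ * Real.exp a₂' * K₀ 64 8 * 64 ≤ a₂' ∧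
      18 * ((1 - 7 * c.δ) * ((c.L : ℝ) / 2) * c.κ) ≤ (c.κ₁ - 1) / 2 ∧
      0 ≤ a₅ ∧ a₅ + Real.exp (-((c.κ₁ - 1) / 2)) ≤ Aabs ∧ Aabs * 64 ≤ c.δ * ((c.L : ℝ) / 2) * c.κ ∧
      B13Step237.bracketF c (K₀ 64 8 * Real.exp (Real.exp (-(a / 20)) * 64)) / c.α₆ * Real.exp (Aabs * 64) ≤
        c.C3act * c.ε₁ ∧
      0 ≤ c.C3act * c.ε₁ ∧ c.κ + 2 * (64 * Real.log 162) + 2 ≤ (1 - 8 * c.δ) * ((c.L : ℝ) / 2) * c.κ ∧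
      c.C3act * c.ε₁ * Real.exp (5 * c.κ + 1) * K₀ 64 8 * 9 * 64 ≤ 1 ∧
      Real.exp 1 * 9 * 64 * K₀ 64 8 ^ 2 ≤ c.A₂ ∧ c.R22 ∧ c.R23 ∧ c.R24sharp ∧ 0 ≤ c.E₀ ∧
      0 ≤ Bc ∧ Bc * 64 ≤ c.E₀ / 2 :=
  ⟨consts, 1, aw, 1, 1, 0, 1, 1 / 64, c_L, Nat.one_pos, c_ε₁, c_α₆, c_eps2, c_δ, c_δ7, c_κ, aw_nonneg, c_R15, c_R16,
    c_R16', c_R17, c_231, zero_le_one, c_κ229, c_sm229, c_absk, c_18half, c_18sharp, zero_le_one, c_κ229', c_sm229,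
    c_R20, le_refl _, c_abs, c_Ac, c_C3, c_C3pos, c_large, c_small, c_A₂, c_R22, c_R23, c_R24, c_E₀, by norm_num,
    c_E₀def⟩

open Classical in
/-- **THE §2 TORUS CHAIN AT THE WITNESS CONSTANTS.** `B13Lemma3TorusTerms.deliverables_torus_termwise_of_226`
specialized to `c = consts` (so L = 8: the two tori are `tsys 4 (8·N′)` ⊂ `tsys 4 N′` of `TwoTorusStep 4 8 N′`), bonds
of the unit torus with cube side 1, rate `a = aw`, `a₅ = 0`, `Bc = 1/64`: every numerical hypothesis is discharged by
the witness, and what remains are the model's structural inputs only — termwise domination and (2.26) per term (`hH`,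
`h226`), the small-field monotonicity `hsp`, (2.13) over `TTouch` `h213`, the restriction record `W.Restr`, the
log Z^{(k)} leaf `hlog`, (I.1.7) `W.Repr17`, analyticity and gauge invariance — delivering the clauses of Theorem I.3
(p. 21) on the torus.  Window version: `B13Lemma3WindowNonvacuity.deliverables_window_consts`. [cite: Balaban1988RG2Cluster, pp.17–22 (Lemma 3 to Theorem I.3)] -/
theorem deliverables_torus_consts {N' : ℕ} [NeZero N'] (W : TwoTorusStep 4 8 N')
    (T : (Z : TDom 4 N') → Finset (TDom 4 (8 * N')) × Finset (TBond 4 1 (8 * N')) → W.Φ → ℂ)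
    (hH : ∀ (Z : TDom 4 N') (φ : W.Φ), φ ∈ W.sp2 Z → ‖W.H Z φ‖ ≤ ∑ t ∈ terms 8 1 Z, ‖T Z t φ‖)
    (h226 : ∀ (Z : TDom 4 N') (φ : W.Φ), φ ∈ W.sp2 Z → ∀ t ∈ terms 8 1 Z,
      ‖T Z t φ‖ ≤ weight 8 1 consts Z aw t)
    (hsp : ∀ X Z : (tsys 4 N').Dom, ∀ φ, Z.1 ⊆ X.1 → φ ∈ W.sp2 X → φ ∈ W.sp2 Z)
    (h213 : ∀ X : (tsys 4 N').Dom, ∀ φ, φ ∈ W.sp2 X →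
      W.Ek1 X φ = locE (TTouch (d := 4) (N := N')) (fun Z : (tsys 4 N').Dom => Z.1) (fun Z => W.H Z φ) X.1)
    (hR : W.Restr)
    (hlog : B13.LogHalfBound W.toStepData.Dk1 W.toStepData.sp2 W.toStepData.Elog (fun X => X.1.card) (1 / 64)
      (consts.δ₀ * consts.M))
    (hrepr : W.Repr17) (han : ∀ X, W.Analytic (W.toStepData.Etot X) (W.sp2 X))
    (hg : ∀ X, W.GaugeInv (W.toStepData.Etot X)) :
    B13.Deliverables W.toStepData consts :=
  B13Lemma3TorusTerms.deliverables_torus_termwise_of_226 (L := 8) (M := 1) consts c_L rfl W T (a₂ := 1) (a₂' := 1)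
    (a₅ := 0) (Aabs := 1) hH
    (fun Z φ hφ t ht => by rw [zero_mul, Real.exp_zero, mul_one]; exact h226 Z φ hφ t ht)
    c_α₆ c_eps2 c_δ c_δ7 c_κ aw_nonneg c_R15 c_R16 c_R16' c_R17 c_231 zero_le_one c_κ229 c_sm229 c_absk c_18half
    c_18sharp zero_le_one c_κ229' c_sm229 c_R20 (le_refl _) c_abs c_Ac c_C3 hsp h213 c_C3pos c_large c_small c_A₂ hR
    c_R22 c_R23 c_R24 c_E₀ (by norm_num) hlog c_E₀def hrepr han hg

/-! ## Part 5. Non-vacuity with a POSITIVE volume rate a₅ and the (2.18) contour-radius clauses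

p. 20, verbatim: *"This exponential is of the same type as the last exponential in (2.37), which can be written as
exp O(1)(LM)⁴α₅(LM)⁻⁴|Z|. Let us recall the definition of the constant α₅: α₅ = O(1)e^{−1/3δ₀M} + O(α₀ + α₁) +
O(1)α₄ + γ₂. … Then O(1)(LM)⁴α₅ + exp(−½(κ₁ − 1)) is bounded by an absolute constant."*  In print the rate
`a₅` (= O(1)(LM)⁴α₅) multiplying |Z| in the last factor «exp O(1)α₅|Z|» of (2.26)/(2.37) is a genuinely POSITIVE
number, absorbed together with `exp(−½(κ₁ − 1))` into the absolute constant `Aabs`; the Part 4 witness took the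
degenerate value `a₅ = 0`.  Part 5 records the same 46 restrictions at the SAME constants `consts` with `a₅ = ½`
(`½ + e^{−18μ} ≤ 1` because `μ = (19/10)κ ≥ 2432`), together with three clauses on `c` alone that the per-term
(2.14)-integrals need for the `τ(Y)`-contours: `κ₁ ≥ 1` and, for every `d = d_k(Y) ≥ 0`, `0 < 1/|τ(Y)| ≤ ½` for the
printed radius (2.18) p. 16 *"1/|τ(Y)| = E₀ε₁C₁α₄⁻¹M^q exp C₂κ₁ exp(−(1 − 3δ)κd_k(Y))"* (`B13Bound143.invTau`) — the
contour `|τ(Y)|` of (2.14) p. 15 then has radius ≥ 2 around the unit interval of `t(Y)`, which is what the factor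
*"2/|τ(Y)|"* of the first estimate (2.15) p. 15 uses.  At the witness, `1/|τ(Y)| = ½ε₂α₆·e^{−(1−3δ)κd}` exactly
(the `exp C₂κ₁` cancels against `ε₁ = ε₂α₆e^{−κ₁}/4`), and `ε₂, α₆ ≤ 1`. -/

/-- κ₁ ≥ 1 at the witness (κ₁ = 1 + 36μ, μ ≥ 0); private plumbing. [folklore] -/
private theorem c_κ₁ : 1 ≤ consts.κ₁ := by
  show (1 : ℝ) ≤ 1 + 36 * μw
  linarith [μw_nonneg]

/-- `e^{−1} ≤ ½` (from `1 + 1 ≤ e`). [folklore] -/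
private theorem exp_neg_one_le_half : Real.exp (-1) ≤ 1 / 2 := by
  have h2 : (2 : ℝ) ≤ Real.exp 1 := by linarith [Real.add_one_le_exp (1 : ℝ)]
  rw [Real.exp_neg, inv_le_comm₀ (Real.exp_pos 1) (by norm_num : (0 : ℝ) < 1 / 2)]
  calc (1 / 2 : ℝ)⁻¹ = 2 := by norm_num
    _ ≤ Real.exp 1 := h2

/-- a₅ + e^{−(κ₁−1)/2} ≤ Aabs with a₅ = ½, Aabs = 1 at the witness (p. 20: *"O(1)(LM)⁴α₅ + exp(−½(κ₁ − 1)) is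
bounded by an absolute constant"*): (κ₁ − 1)/2 = 18μ ≥ 1, so e^{−18μ} ≤ e^{−1} ≤ ½; private plumbing.
[cite: Balaban1988RG2Cluster, p.20 (the sentence fixing the absolute constant)] -/
private theorem c_abs_half : 1 / 2 + Real.exp (-((consts.κ₁ - 1) / 2)) ≤ 1 := by
  show 1 / 2 + Real.exp (-((1 + 36 * μw - 1) / 2)) ≤ 1
  have hμ : 1 ≤ 18 * μw := by rw [μw_eq]; linarith [κw_ge]
  have h1 : Real.exp (-((1 + 36 * μw - 1) / 2)) ≤ Real.exp (-1) := by
    rw [Real.exp_le_exp]; linarith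
  linarith [exp_neg_one_le_half]

/-- **(2.18) at the witness.** p. 16 [16], verbatim: *"1/|τ(Y)| = E₀ε₁C₁α₄⁻¹M^q exp C₂κ₁ exp(−(1 − 3δ)κd_k(Y))"*
— at `consts` (E₀ = 2, C₁ = α₄ = C₂ = 1, q = 0, ε₁ = ε₂α₆e^{−κ₁}/4) this is `½·ε₂·α₆·e^{−(1−3δ)κd}`: the factor
`exp C₂κ₁` cancels. [cite: Balaban1988RG2Cluster, (2.18) p.16] -/
private theorem invTau_consts (d : ℝ) :
    B13Bound143.invTau consts d = ε₂w * α₆w / 2 * Real.exp (-(1 - 3 * δw) * κw * d) := by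
  unfold B13Bound143.invTau
  show 2 * (ε₂w * α₆w * Real.exp (-κ₁t) / 4) * 1 * (1 : ℝ)⁻¹ * (κw + 1) ^ (0 : ℕ) * Real.exp (1 * κ₁t) *
      Real.exp (-(1 - 3 * δw) * κw * d) = ε₂w * α₆w / 2 * Real.exp (-(1 - 3 * δw) * κw * d)
  have h : Real.exp (-κ₁t) * Real.exp (1 * κ₁t) = 1 := by
    rw [← Real.exp_add, one_mul, neg_add_cancel, Real.exp_zero]
  calc 2 * (ε₂w * α₆w * Real.exp (-κ₁t) / 4) * 1 * (1 : ℝ)⁻¹ * (κw + 1) ^ (0 : ℕ) * Real.exp (1 * κ₁t) *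
        Real.exp (-(1 - 3 * δw) * κw * d)
      = ε₂w * α₆w / 2 * (Real.exp (-κ₁t) * Real.exp (1 * κ₁t)) * Real.exp (-(1 - 3 * δw) * κw * d) := by ring
    _ = ε₂w * α₆w / 2 * Real.exp (-(1 - 3 * δw) * κw * d) := by rw [h, mul_one]

/-- `0 < 1/|τ(Y)| ≤ ½` at the witness for every `d_k(Y) ≥ 0`: the `τ(Y)`-contour of (2.14) has radius `|τ(Y)| ≥ 2`
(what the factor *"2/|τ(Y)|"* of the first estimate (2.15) p. 15 uses), since `ε₂, α₆ ≤ 1` and `(1 − 3δ)κ > 0` at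
δ = 3/40; private plumbing. [cite: Balaban1988RG2Cluster, (2.18) p.16 and (2.15) p.15] -/
private theorem c_invTau (d : ℝ) (hd : 0 ≤ d) :
    0 < B13Bound143.invTau consts d ∧ B13Bound143.invTau consts d ≤ 1 / 2 := by
  rw [invTau_consts]
  have hE1 : Real.exp (-(1 - 3 * δw) * κw * d) ≤ 1 := by
    rw [Real.exp_le_one_iff]
    have h31 : 0 ≤ (1 - 3 * δw) * κw * d := by
      have hδ : 0 ≤ 1 - 3 * δw := by unfold δw; norm_num
      exact mul_nonneg (mul_nonneg hδ κw_pos.le) hd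
    linarith
  have hεα : ε₂w * α₆w ≤ 1 := by
    calc ε₂w * α₆w ≤ 1 * 1 := mul_le_mul ε₂w_le_one α₆w_le_one α₆w_pos.le zero_le_one
      _ = 1 := one_mul 1
  have hpos : 0 < ε₂w * α₆w / 2 := by have := ε₂w_pos; have := α₆w_pos; positivity
  refine ⟨mul_pos hpos (Real.exp_pos _), ?_⟩
  calc ε₂w * α₆w / 2 * Real.exp (-(1 - 3 * δw) * κw * d) ≤ ε₂w * α₆w / 2 * 1 :=
        mul_le_mul_of_nonneg_left hE1 hpos.le
    _ ≤ 1 / 2 := by linarith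

/-- **NON-VACUITY OF THE NUMERICAL RESTRICTIONS OF THE TORUS CHAIN WITH A POSITIVE VOLUME RATE `a₅` AND THE (2.18)
CONTOUR CLAUSES.** The 46 restrictions of `numerics_nonvacuous` (verbatim, same order) hold at the SAME constants
`consts`, `M = 1`, `a = aw`, `a₂ = a₂' = 1`, `Aabs = 1`, `Bc = 1/64` but with the volume rate `a₅ = ½ > 0` of the last
factor «exp O(1)α₅|Z|» of (2.26)/(2.37) — p. 20, verbatim: *"α₅ = O(1)e^{−1/3δ₀M} + O(α₀ + α₁) + O(1)α₄ + γ₂. … Then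
O(1)(LM)⁴α₅ + exp(−½(κ₁ − 1)) is bounded by an absolute constant."* (a positive rate in print; Part 4 certified only
the degenerate `a₅ = 0`) — and, in addition, three clauses on the constants alone that the `τ(Y)`-contours of the
(2.14)-terms read: `κ₁ ≥ 1` and `0 < 1/|τ(Y)| ≤ ½` for the printed radius (2.18) p. 16 (`B13Bound143.invTau`) at every
`d_k(Y) ≥ 0` (contour radius ≥ 2, as used by the factor 2/|τ(Y)| of (2.15) p. 15).  The witness certifies only that
the inequalities as typed are jointly consistent with `a₅ > 0`; it says nothing about the size of the physical
constants. [cite: Balaban1988RG2Cluster, p.20 (definition of α₅ and the absolute constant), (2.18) p.16, p.21 (closing paragraph: "The assumptions allow finally us to fix all the constants")] -/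
theorem numerics_nonvacuous_pos :
    ∃ (c : B13.Consts) (M : ℕ) (a a₂ a₂' a₅ Aabs Bc : ℝ),
      8 ≤ c.L ∧ 0 < M ∧ 0 < c.ε₁ ∧ 0 < c.α₆ ∧ 0 ≤ c.eps2 ∧ 0 ≤ c.δ ∧ 0 ≤ 1 - 7 * c.δ ∧ 0 ≤ c.κ ∧ 0 ≤ a ∧
      c.R15 ∧ 18 * ((1 - 4 * c.δ) * c.κ) ≤ a / 20 ∧ 4 * c.κ ≤ a / 20 ∧ Real.exp (-(a / 20)) ≤ c.eps2 ∧
      2 * (4 : ℝ) * (M : ℝ) ^ 4 * Real.exp (-(a / 10)) ≤ a / 20 ∧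
      0 ≤ a₂ ∧ kappa₀ 64 8 + a₂ ≤ c.δ * c.κ ∧ c.α₆ * Real.exp a₂ * K₀ 64 8 * 64 ≤ a₂ ∧
      Real.exp (-(a / 20)) * 64 ≤ c.δ * c.κ ∧
      B13Step237.R18half c (K₀ 64 8 * Real.exp (Real.exp (-(a / 20)) * 64)) ∧
      B13Step237.R18sharp c (K₀ 64 8 * Real.exp (Real.exp (-(a / 20)) * 64)) ((c.L : ℝ) / 2) ∧
      0 ≤ a₂' ∧ kappa₀ 64 8 + a₂' ≤ c.δ * ((c.L : ℝ) / 2) * c.κ ∧ c.α₆ * Real.exp a₂' * K₀ 64 8 * 64 ≤ a₂' ∧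
      18 * ((1 - 7 * c.δ) * ((c.L : ℝ) / 2) * c.κ) ≤ (c.κ₁ - 1) / 2 ∧
      0 ≤ a₅ ∧ a₅ + Real.exp (-((c.κ₁ - 1) / 2)) ≤ Aabs ∧ Aabs * 64 ≤ c.δ * ((c.L : ℝ) / 2) * c.κ ∧
      B13Step237.bracketF c (K₀ 64 8 * Real.exp (Real.exp (-(a / 20)) * 64)) / c.α₆ * Real.exp (Aabs * 64) ≤
        c.C3act * c.ε₁ ∧
      0 ≤ c.C3act * c.ε₁ ∧ c.κ + 2 * (64 * Real.log 162) + 2 ≤ (1 - 8 * c.δ) * ((c.L : ℝ) / 2) * c.κ ∧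
      c.C3act * c.ε₁ * Real.exp (5 * c.κ + 1) * K₀ 64 8 * 9 * 64 ≤ 1 ∧
      Real.exp 1 * 9 * 64 * K₀ 64 8 ^ 2 ≤ c.A₂ ∧ c.R22 ∧ c.R23 ∧ c.R24sharp ∧ 0 ≤ c.E₀ ∧
      0 ≤ Bc ∧ Bc * 64 ≤ c.E₀ / 2 ∧
      0 < a₅ ∧ 1 ≤ c.κ₁ ∧
      (∀ d : ℝ, 0 ≤ d → 0 < B13Bound143.invTau c d ∧ B13Bound143.invTau c d ≤ 1 / 2) :=
  ⟨consts, 1, aw, 1, 1, 1 / 2, 1, 1 / 64, c_L, Nat.one_pos, c_ε₁, c_α₆, c_eps2, c_δ, c_δ7, c_κ, aw_nonneg, c_R15,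
    c_R16, c_R16', c_R17, c_231, zero_le_one, c_κ229, c_sm229, c_absk, c_18half, c_18sharp, zero_le_one, c_κ229',
    c_sm229, c_R20, by norm_num, c_abs_half, c_Ac, c_C3, c_C3pos, c_large, c_small, c_A₂, c_R22, c_R23, c_R24, c_E₀,
    by norm_num, c_E₀def, by norm_num, c_κ₁, c_invTau⟩


/-! ## Part 6. The same witness with the record NAMED (block size `L = 8` readable)

Part 5 packages the witness behind `∃ c`, so a consumer cannot read `c.L = 8` off it; the Summits-side row NE5 of cell
`pub-balaban-gaps` (`Spine/NE5/TwoRunTorusNE5AllL.lemma3_witness_transfer`, which carries the 41 conjuncts from `c.L` to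
every larger block size — [Balaban1987RG1] p. 251 *"L is an odd, positive integer > 11"*) then only obtains a threshold
`L₀ = c.L` hidden by the `∃`.  This part states the 41 conjuncts of `numerics_nonvacuous_pos` AT the witness `consts`
(bond-cube side `1`, rate `aw`, `a₂ = a₂' = 1`, `a₅ = ½`, `Aabs = 1`, `Bc = 1/64`) — the same private lemmas, no new
mathematics — so that `consts.L = 8` (`rfl`) makes the threshold explicit.  Consistency of the typed list, nothing
about the size of Bałaban's constants. -/

/-- **The 41 conjuncts of `numerics_nonvacuous_pos` at the NAMED witness** `consts` (L = 8, δ = 3/40), bond-cube side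
`1`, rate `aw`, `a₂ = a₂' = 1`, `a₅ = ½`, `Aabs = 1`, `Bc = 1/64` — restrictions R15–R18, R20, R22–R24 of pp. 17–21, the
smallness of (2.29)/(2.31), the O(1) of (2.37)/(2.38)/(2.41), the ½E₀ bookkeeping, `a₅ > 0`, `κ₁ ≥ 1` and the (2.18)
contour-radius clauses, VERBATIM and in the same order; `numerics_nonvacuous_pos` is its `∃`-packaging.  The witness
certifies only that the inequalities as typed are jointly consistent. [cite: Balaban1988RG2Cluster, p.21 (closing paragraph: "The assumptions allow finally us to fix all the constants"), (2.18) p.16, (2.31) p.18, p.20 (before (2.37))] -/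
theorem numerics_nonvacuous_pos_consts :
    8 ≤ consts.L ∧ 0 < (1 : ℕ) ∧ 0 < consts.ε₁ ∧ 0 < consts.α₆ ∧ 0 ≤ consts.eps2 ∧ 0 ≤ consts.δ ∧
      0 ≤ 1 - 7 * consts.δ ∧ 0 ≤ consts.κ ∧ 0 ≤ aw ∧
      consts.R15 ∧ 18 * ((1 - 4 * consts.δ) * consts.κ) ≤ aw / 20 ∧ 4 * consts.κ ≤ aw / 20 ∧
      Real.exp (-(aw / 20)) ≤ consts.eps2 ∧
      2 * (4 : ℝ) * ((1 : ℕ) : ℝ) ^ 4 * Real.exp (-(aw / 10)) ≤ aw / 20 ∧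
      0 ≤ (1 : ℝ) ∧ kappa₀ 64 8 + 1 ≤ consts.δ * consts.κ ∧ consts.α₆ * Real.exp 1 * K₀ 64 8 * 64 ≤ 1 ∧
      Real.exp (-(aw / 20)) * 64 ≤ consts.δ * consts.κ ∧
      B13Step237.R18half consts (K₀ 64 8 * Real.exp (Real.exp (-(aw / 20)) * 64)) ∧
      B13Step237.R18sharp consts (K₀ 64 8 * Real.exp (Real.exp (-(aw / 20)) * 64)) ((consts.L : ℝ) / 2) ∧
      0 ≤ (1 : ℝ) ∧ kappa₀ 64 8 + 1 ≤ consts.δ * ((consts.L : ℝ) / 2) * consts.κ ∧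
      consts.α₆ * Real.exp 1 * K₀ 64 8 * 64 ≤ 1 ∧
      18 * ((1 - 7 * consts.δ) * ((consts.L : ℝ) / 2) * consts.κ) ≤ (consts.κ₁ - 1) / 2 ∧
      (0 : ℝ) ≤ 1 / 2 ∧ 1 / 2 + Real.exp (-((consts.κ₁ - 1) / 2)) ≤ 1 ∧ 1 * 64 ≤ consts.δ * ((consts.L : ℝ) / 2) * consts.κ ∧
      B13Step237.bracketF consts (K₀ 64 8 * Real.exp (Real.exp (-(aw / 20)) * 64)) / consts.α₆ * Real.exp (1 * 64) ≤
        consts.C3act * consts.ε₁ ∧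
      0 ≤ consts.C3act * consts.ε₁ ∧
      consts.κ + 2 * (64 * Real.log 162) + 2 ≤ (1 - 8 * consts.δ) * ((consts.L : ℝ) / 2) * consts.κ ∧
      consts.C3act * consts.ε₁ * Real.exp (5 * consts.κ + 1) * K₀ 64 8 * 9 * 64 ≤ 1 ∧
      Real.exp 1 * 9 * 64 * K₀ 64 8 ^ 2 ≤ consts.A₂ ∧ consts.R22 ∧ consts.R23 ∧ consts.R24sharp ∧ 0 ≤ consts.E₀ ∧
      0 ≤ (1 / 64 : ℝ) ∧ 1 / 64 * 64 ≤ consts.E₀ / 2 ∧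
      (0 : ℝ) < 1 / 2 ∧ 1 ≤ consts.κ₁ ∧
      (∀ d : ℝ, 0 ≤ d → 0 < B13Bound143.invTau consts d ∧ B13Bound143.invTau consts d ≤ 1 / 2) :=
  ⟨c_L, Nat.one_pos, c_ε₁, c_α₆, c_eps2, c_δ, c_δ7, c_κ, aw_nonneg, c_R15,
    c_R16, c_R16', c_R17, c_231, zero_le_one, c_κ229, c_sm229, c_absk, c_18half, c_18sharp, zero_le_one, c_κ229',
    c_sm229, c_R20, by norm_num, c_abs_half, c_Ac, c_C3, c_C3pos, c_large, c_small, c_A₂, c_R22, c_R23, c_R24, c_E₀,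
    by norm_num, c_E₀def, by norm_num, c_κ₁, c_invTau⟩

/-- The block size of the named witness is `8` (definitional; recorded for consumers that quantify `∀ L ≥ consts.L`).
[cite: Balaban1988RG2Cluster, p.21 (closing paragraph)] -/
theorem consts_L : consts.L = 8 := rfl

end

end Literature.MathematicalPhysics.QuantumFieldTheory.Balaban1983to89.B13Lemma3TorusNonvacuity
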